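import Literature.Topology.FourManifolds.CappellShanesonClassNumberOneLarge
import HarnessLib

/-!
# Gompf equivalence of Cappell–Shaneson matrices and Kim–Yamada's Remark 1.1

Sibling of `CappellShanesonGompfReduction.lean` / `CappellShanesonTraceClasses.lean`, serving the
named fact `Literature.Topology.FourManifolds.kimYamada2023_nonempty_diffeomorph_sphere_four_of_trace_mem_Icc`
of `CappellShaneson.lean` (M. H. Kim, S. Yamada, *Ideal classes and Cappell–Shaneson homotopy
4-spheres*, Kyungpook Math. J. 63 (2023) 373–411 = arXiv:1707.03860, Cor. C: every
Cappell–Shaneson sphere of a matrix `A ∈ SL(3, ℤ)`, `det (A - I) = 1`, `-64 ≤ tr A ≤ 69`, is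
`S⁴`). In the paper Cor. C "immediately follows" (§1.2) from

* **Theorem B**: "Conjecture 2 [Gompf: every Cappell–Shaneson matrix is Gompf equivalent to `A₀`]
  is true for trace `n` if `-64 ≤ n ≤ 69`" — pure algebra / number theory (ideal class monoids
  `C(ℤ[Θₙ])`, `3 ≤ n ≤ 69`, computed with MAGMA, Thm. A for `n ↦ 5 - n`, and explicit Gompf
  equivalences), and
* **Remark 1.1**: "If Conjecture 2 is true for trace `n`, then Conjecture 1 [`Σ_A^ε ≅ S⁴` for every
  `ε`] is true for every matrix with trace `n`" — which is Gompf's theorem that Gompf equivalent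
  matrices give diffeomorphic spheres (Gompf, Algebr. Geom. Topol. 10 (2010), Thm. 2.1/§3; KY
  Thm. 2.16, Remark 2.17) together with "both spheres of `A₀` are standard".

This file vendors the DEFINITION of Gompf equivalence (KY Def. 2.18) and PROVES Remark 1.1 relative
to the tree's three topological leaves (`gompf2010_deltaMove`, `gompf2010_akbulutKirby_framings`,
`akbulutKirby1979_sphere_four` of `CappellShanesonGompfReduction.lean`), so that the named fact is
reduced to Theorem B in purely matrix-theoretic form:
`kimYamada2023_nonempty_diffeomorph_sphere_four_of_trace_mem_Icc_of`. It also proves, outright,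
Gompf's conjecture for the traces `-4 ≤ n ≤ 9` (`gompfConjectureForTrace_of_mem_Icc`, from the
discharged Aitchison–Rubinstein class-number-one fact `aitchisonRubinstein1984_uniqueTraceClass_holds`)
and for the family `Aₘ` (`gompfEquiv_cappellShanesonMatrix_akbulutKirbyMatrix`, Gompf's Examples
3.1(a)), and the trace `-5` case from the two-class fact (Examples 3.1(b)).

## Rendering of Gompf equivalence

KY Def. 2.18 defines `∼` on the *standard* matrices `X_{c,d,n} = !![0, a, b; 0, c, d; 1, 0, n - c]`
as generated by `X_{c₀,d₀,n} ∼_S X_{c₁,d₁,n}` iff the ideal classes `[⟨Θₙ - cᵢ, dᵢ⟩]` agree — iff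
the matrices are similar (Remark 2.21, Prop. 2.14; "similar" = conjugate by `C ∈ SL(3, ℤ)`, §2.1)
— and `X_{c,d,n} ∼_G X_{c,d,n+kd}`, which is the Δ-move `A ↦ Δᵏ A` followed by a shear conjugation
(Remarks 2.9, 2.17). We render it on all of `SL(3, ℤ)` as the equivalence relation `GompfEquiv`
generated (`Relation.EqvGen`) by `IsGompfMove A B`: `A`, `B` conjugate in `SL(3, ℤ)` (= in
`GL(3, ℤ)`, odd size, `isConj_iff_exists_isUnit_det`), or `B = Δᵏ A` for `A` a Cappell–Shaneson
matrix in Gompf's standard form (`IsGompfStandardForm`, any `e`). On standard matrices the two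
relations agree (a standard-form `A` with entry `e` is conjugate to `X_{c,d,n}` and `Δᵏ A` to
`X_{c,d,n+kd}`, Remark 2.9), and "Conjecture 2 is true for trace `n`" (§1.2) becomes
`GompfConjectureForTrace n`: every `A` with `det (A - 1) = 1` and trace `n` is Gompf equivalent to
`A₀ = akbulutKirbyMatrix` (for non-standard `A` KY pass through Aitchison–Rubinstein's Thm. 2.6,
"every Cappell–Shaneson matrix is similar to a standard one", which the conjugation generator
absorbs).

## Design

* Framing-free, as everywhere in the tree: `IsCappellShanesonSphereOf A X` quantifies over the
  tubular neighbourhood, so "the pair `{Σ_A^0, Σ_A^1}`" is `{X | IsCappellShanesonSphereOf A X}`;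
  the transport statement is `IsCappellShanesonSphereOf A X ↔ IsCappellShanesonSphereOf B X` for
  the SAME `X : Type u` (after a Δ-move `X ≅ X'` the structure of `X'` is pulled back along the
  diffeomorphism, `IsCappellShanesonSphereOf.of_diffeomorph`), which keeps one universe `u` and
  needs `gompf2010_deltaMove.{u}` only.
* No new named facts: Theorem B enters `…_of` as an explicit hypothesis
  `∀ n ∈ [-64, 69], GompfConjectureForTrace n`; the three topological leaves are the existing ones.
* Deliberately NOT here: Theorem B itself (the tables of `C(ℤ[Θₙ])`, `3 ≤ n ≤ 69`, need the
  Latimer–MacDuffee–Taussky correspondence beyond class number one and ideal-class-monoid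
  computations for 67 cubic orders, several non-Dedekind), Theorem A (`ℤ[Θₙ] ≅ ℤ[Θ_{5-n}]`),
  Cor. D, and Gompf's column move `A ↦ A Δᵏ` (not needed: `A Δᵏ` is conjugate to `Δᵏ A`).

## References

* [KimYamada2023] M. H. Kim, S. Yamada, Kyungpook Math. J. 63 (2023) 373–411 (arXiv:1707.03860):
  §1.1–1.2 (Conjectures 1, 2, Remark 1.1, Thm. B, Cor. C), §2.1 (Def. 2.1, Remarks 2.3, 2.9),
  §2.4 (Thm. 2.16, Remark 2.17, Def. 2.18, Remarks 2.21, 2.22).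
* [GompfAGT2010] R. E. Gompf, Algebr. Geom. Topol. 10 (2010) 1665–1681, Thm. 2.1, §3 (standard
  form, Δ, Examples 3.1(a),(b), Thm. 3.2).
* [AitchisonRubinstein1984] I. R. Aitchison, J. H. Rubinstein, Contemp. Math. 35 (1984), Appendix,
  Table 1.
-/

noncomputable section

open Set
open scoped Manifold ContDiff MatrixGroups

namespace Literature.Topology.FourManifolds

universe u

/-- Local notation: `𝔼 n` is the model Euclidean space `EuclideanSpace ℝ (Fin n)`. -/
local notation "𝔼 " n:arg => EuclideanSpace ℝ (Fin n)

/-- Local notation: `𝕊 n` is the unit sphere in `EuclideanSpace ℝ (Fin (n + 1))`. -/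
local notation "𝕊 " n:arg => (Metric.sphere (0 : EuclideanSpace ℝ (Fin (n + 1))) 1)

/-! ### Gompf moves and Gompf equivalence -/

section Definitions

/-- **A Gompf move** between matrices `A, B ∈ SL(3, ℤ)` — one generating step of Gompf equivalence
(Kim–Yamada 2023, Def. 2.18 with Remark 2.21; Gompf 2010, §3): either `A` and `B` are similar
(conjugate in `SL(3, ℤ)`; KY §2.1, Remark 2.3: similar matrices give diffeomorphic spheres), or `A`
is a Cappell–Shaneson matrix (`det (A - 1) = 1`) in Gompf's standard form
`!![0, a, b; 0, c, d; 1, e, f]` and `B = Δᵏ A` is obtained by the row Δ-move of Gompf's Thm. 2.1/§3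
(KY Thm. 2.16; together with the conjugation `Δᵏ A ∼ X_{c,d,n+kd}` of Remark 2.9 this is KY's
generator `X_{c,d,n} ∼_G X_{c,d,n+kd}`). [cite: KimYamada2023, Def. 2.18 and Remark 2.21] -/
def IsGompfMove (A B : SL(3, ℤ)) : Prop :=
  IsConj A B ∨
    (IsGompfStandardForm A ∧ ((A : Matrix (Fin 3) (Fin 3) ℤ) - 1).det = 1 ∧
      ∃ k : ℤ, B = gompfDelta ^ k * A)

/-- **Gompf equivalence** (Kim–Yamada 2023, Def. 2.18: "an equivalence relation `∼`, called Gompf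
equivalence, on the set of standard matrices generated by `∼_S` [same ideal class, i.e. similar,
Remark 2.21] and `∼_G` [`X_{c,d,n} ∼_G X_{c,d,n+kd}`]"; introduced by Gompf, Algebr. Geom. Topol.
10 (2010), §3), rendered on all of `SL(3, ℤ)` as the equivalence relation generated by
`IsGompfMove` (see the module docstring for why this agrees with KY's relation on standard
matrices). Gompf equivalent Cappell–Shaneson matrices have the same Cappell–Shaneson spheres
(`GompfEquiv.isCappellShanesonSphereOf_iff`, KY Thm. 2.16 / Remark 2.17, granted Gompf's Thm. 2.1). [cite: KimYamada2023, Def. 2.18] -/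
def GompfEquiv : SL(3, ℤ) → SL(3, ℤ) → Prop :=
  Relation.EqvGen IsGompfMove

/-- Gompf equivalence is an equivalence relation (by construction, `Relation.EqvGen`). [cite: KimYamada2023, Def. 2.18] -/
theorem equivalence_gompfEquiv : Equivalence GompfEquiv :=
  Relation.EqvGen.is_equivalence _

namespace GompfEquiv

/-- Reflexivity of Gompf equivalence. [cite: KimYamada2023, Def. 2.18] -/
protected theorem refl (A : SL(3, ℤ)) : GompfEquiv A A :=
  Relation.EqvGen.refl A

/-- Symmetry of Gompf equivalence. [cite: KimYamada2023, Def. 2.18] -/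
protected theorem symm {A B : SL(3, ℤ)} (h : GompfEquiv A B) : GompfEquiv B A :=
  Relation.EqvGen.symm _ _ h

/-- Transitivity of Gompf equivalence. [cite: KimYamada2023, Def. 2.18] -/
protected theorem trans {A B C : SL(3, ℤ)} (h₁ : GompfEquiv A B) (h₂ : GompfEquiv B C) :
    GompfEquiv A C :=
  Relation.EqvGen.trans _ _ _ h₁ h₂

/-- A Gompf move is a Gompf equivalence. [cite: KimYamada2023, Def. 2.18] -/
theorem of_isGompfMove {A B : SL(3, ℤ)} (h : IsGompfMove A B) : GompfEquiv A B :=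
  Relation.EqvGen.rel _ _ h

/-- **Similar matrices are Gompf equivalent** (the generator `∼_S`, KY Remark 2.21: "`(c₀,d₀,n) ∼_S
(c₁,d₁,n)` if and only if `X_{c₀,d₀,n}` and `X_{c₁,d₁,n}` are similar"). [cite: KimYamada2023, Def. 2.18 and Remark 2.21] -/
theorem of_isConj {A B : SL(3, ℤ)} (h : IsConj A B) : GompfEquiv A B :=
  of_isGompfMove (Or.inl h)

/-- Conjugation `A ↦ P A P⁻¹` is a Gompf equivalence. [cite: KimYamada2023, Def. 2.18 and Remark 2.21] -/
theorem conj (A P : SL(3, ℤ)) : GompfEquiv A (P * A * P⁻¹) :=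
  of_isConj ((isConj_iff_exists_eq_conj A _).2 ⟨P, rfl⟩)

/-- **The Δ-move is a Gompf equivalence** (the generator `∼_G`): for a Cappell–Shaneson matrix `A`
in standard form, `A ∼ Δᵏ A` for every `k ∈ ℤ` (KY Thm. 2.16 / Remark 2.17; Gompf 2010, §3). [cite: KimYamada2023, Def. 2.18 and Remark 2.17] -/
theorem gompfDelta_zpow_mul {A : SL(3, ℤ)} (hA : IsGompfStandardForm A)
    (hdet : ((A : Matrix (Fin 3) (Fin 3) ℤ) - 1).det = 1) (k : ℤ) :
    GompfEquiv A (gompfDelta ^ k * A) :=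
  of_isGompfMove (Or.inr ⟨hA, hdet, k, rfl⟩)

end GompfEquiv

/-- A Gompf move preserves the Cappell–Shaneson determinant `det (A - 1)` (conjugation:
`det_coe_conj_sub_one`; Δ-move: `IsGompfStandardForm.det_gompfDelta_zpow_mul_sub_one`, Gompf 2010,
§§3–4: "`B` is also a Cappell-Shaneson matrix"). [cite: GompfAGT2010, §3 (Δ-moves on matrices in standard form)] -/
theorem IsGompfMove.det_sub_one_eq {A B : SL(3, ℤ)} (h : IsGompfMove A B) :
    ((B : Matrix (Fin 3) (Fin 3) ℤ) - 1).det = ((A : Matrix (Fin 3) (Fin 3) ℤ) - 1).det := by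
  rcases h with h | ⟨hA, -, k, rfl⟩
  · obtain ⟨P, rfl⟩ := (isConj_iff_exists_eq_conj A B).1 h
    exact det_coe_conj_sub_one P A
  · exact hA.det_gompfDelta_zpow_mul_sub_one k

/-- **Gompf equivalence preserves `det (A - 1)`**; in particular a matrix Gompf equivalent to a
Cappell–Shaneson matrix is a Cappell–Shaneson matrix (KY Thm. 2.16: "`A Δᵏ` and `Δᵏ A` are also
[Cappell–Shaneson] matrices"). [cite: KimYamada2023, Thm. 2.16] -/
theorem GompfEquiv.det_sub_one_eq {A B : SL(3, ℤ)} (h : GompfEquiv A B) :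
    ((B : Matrix (Fin 3) (Fin 3) ℤ) - 1).det = ((A : Matrix (Fin 3) (Fin 3) ℤ) - 1).det := by
  induction h with
  | rel A B hAB => exact hAB.det_sub_one_eq
  | refl A => rfl
  | symm A B _ ih => exact ih.symm
  | trans A B C _ _ ih₁ ih₂ => exact ih₂.trans ih₁

/-- **"Conjecture 2 is true for trace `n`"** (Kim–Yamada 2023, §1.2: "we say Conjecture 2 [Gompf:
every Cappell–Shaneson matrix is Gompf equivalent to `A₀`] is true for trace `n` if every
[Cappell–Shaneson] matrix `A` with trace `n` is Gompf equivalent to `A₀`"; Def. 2.20 for the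
reformulation on triples `(c, d, n)`): every `A ∈ SL(3, ℤ)` with `det (A - 1) = 1` and `tr A = n` is
Gompf equivalent to the Akbulut–Kirby matrix `A₀ = X_{1,1,2}`. Gompf's conjecture itself (KY
Conjecture 2, OPEN) is `∀ n, GompfConjectureForTrace n` and is deliberately not given a name here;
Theorem B asserts it for `-64 ≤ n ≤ 69`, and `gompfConjectureForTrace_of_mem_Icc` below PROVES it
for `-4 ≤ n ≤ 9`. [cite: KimYamada2023, §1.2 (Conjecture 2 and the paragraph before Remark 1.1)] -/
def GompfConjectureForTrace (n : ℤ) : Prop :=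
  ∀ A : SL(3, ℤ), ((A : Matrix (Fin 3) (Fin 3) ℤ) - 1).det = 1 →
    Matrix.trace (A : Matrix (Fin 3) (Fin 3) ℤ) = n → GompfEquiv A akbulutKirbyMatrix

end Definitions

/-! ### Examples: the family `Aₘ`, and the traces `[-4, 9]` and `-5` -/

section Examples

/-- **The family `Aₘ` is Gompf equivalent to `A₀`** (Gompf 2010, Examples 3.1(a): "Since `Aₘ` is in
standard form with `d = 1`, we can change it to have any trace, say `2`. The resulting matrix …
must be conjugate to `A₀`"; explicitly `E_m⁻¹ (Δ^{-m} Aₘ) E_m = A₀`,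
`gompfShear_inv_mul_mul_gompfShear`; KY Remark 2.22: "`(1,1,n+2) ∼_G (1,1,2)`"). [cite: GompfAGT2010, Examples 3.1(a)] -/
theorem gompfEquiv_cappellShanesonMatrix_akbulutKirbyMatrix (m : ℤ) :
    GompfEquiv (cappellShanesonMatrix m) akbulutKirbyMatrix := by
  refine (GompfEquiv.gompfDelta_zpow_mul (isGompfStandardForm_cappellShanesonMatrix m)
    (det_cappellShanesonMatrix_sub_one m) (-m)).trans ?_
  have h := GompfEquiv.conj (gompfDelta ^ (-m) * cappellShanesonMatrix m) (gompfShear m)⁻¹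
  rwa [inv_inv, gompfShear_inv_mul_mul_gompfShear] at h

/-- **Gompf's conjecture is true for the traces `-4 ≤ n ≤ 9`**, PROVED: by the discharged
Aitchison–Rubinstein fact `aitchisonRubinstein1984_uniqueTraceClass_holds` ("The class is unique
when `-4 ≤ tr(A) ≤ 9`", Gompf 2010, §3) a Cappell–Shaneson matrix of trace `n ∈ [-4, 9]` is
conjugate to `A_{n-2}`, which is Gompf equivalent to `A₀`. (KY Thm. 2.19, after Gompf's Thm. 3.2:
true for `-6 ≤ n ≤ 9` and `n = 11`; the traces `-6, -5, 11` need the further rows of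
Aitchison–Rubinstein's Table 1, of which only the trace `-5` row is vendored in the tree,
`gompfConjectureForTrace_neg_five_of`.) [cite: GompfAGT2010, Thm. 3.2 (proof)] -/
theorem gompfConjectureForTrace_of_mem_Icc {n : ℤ} (hn : n ∈ Icc (-4 : ℤ) 9) :
    GompfConjectureForTrace n := by
  intro A hdet htr
  have hc := aitchisonRubinstein1984_uniqueTraceClass_holds.isConj_cappellShanesonMatrix A hdet
    (by rw [htr]; exact hn)
  exact (GompfEquiv.of_isConj hc.symm).trans (gompfEquiv_cappellShanesonMatrix_akbulutKirbyMatrix _)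

/-- **Gompf's trace-`-5` matrix `B = !![0, -5, -8; 0, 2, 3; 1, 0, -7]` is Gompf equivalent to `A₀`**
(Gompf 2010, Examples 3.1(b), "exhibiting a Cappell-Shaneson matrix not conjugate to any `Aₘ`"
(§1): "We can easily change its trace to `1`" — the row move `Δ²`, then the explicit conjugation
to `A₋₁`, `isConj_gompfDelta_sq_mul_gompfTraceNegFiveMatrix`; KY §1.1: `B = X_{2,3,-5}`). [cite: GompfAGT2010, Examples 3.1(b)] -/
theorem gompfEquiv_gompfTraceNegFiveMatrix_akbulutKirbyMatrix :
    GompfEquiv gompfTraceNegFiveMatrix akbulutKirbyMatrix :=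
  ((GompfEquiv.gompfDelta_zpow_mul isGompfStandardForm_gompfTraceNegFiveMatrix
    det_gompfTraceNegFiveMatrix_sub_one 2).trans
    (GompfEquiv.of_isConj isConj_gompfDelta_sq_mul_gompfTraceNegFiveMatrix)).trans
    (gompfEquiv_cappellShanesonMatrix_akbulutKirbyMatrix (-1))

/-- **Gompf's conjecture for trace `-5`, from the two-class fact** (Aitchison–Rubinstein, Table 1
and Example `a = -5`; Gompf 2010, Examples 3.1(b)): a Cappell–Shaneson matrix of trace `-5` is
conjugate to `A₋₇` or to `B`, both Gompf equivalent to `A₀`. Conditional on the named fact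
`aitchisonRubinstein1984_traceNegFiveClasses` (class number two of discriminant `2777`, not yet
discharged). [cite: GompfAGT2010, Examples 3.1(b)] -/
theorem gompfConjectureForTrace_neg_five_of (hAR5 : aitchisonRubinstein1984_traceNegFiveClasses) :
    GompfConjectureForTrace (-5) := by
  intro A hdet htr
  rcases hAR5.1 A hdet htr with hc | hc
  · exact (GompfEquiv.of_isConj hc.symm).trans
      (gompfEquiv_cappellShanesonMatrix_akbulutKirbyMatrix _)
  · exact (GompfEquiv.of_isConj hc.symm).trans gompfEquiv_gompfTraceNegFiveMatrix_akbulutKirbyMatrix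

end Examples

/-! ### Gompf equivalent matrices have the same Cappell–Shaneson spheres (KY Thm. 2.16, Remark 2.17) -/

section Transport

variable (X : Type u) [TopologicalSpace X] [T2Space X] [SecondCountableTopology X]
  [ChartedSpace (𝔼 4) X] [IsManifold (𝓡 4) ∞ X] [CompactSpace X]

/-- **A Gompf move does not change the Cappell–Shaneson spheres**, granted Gompf's Thm. 2.1/§3
(`gompf2010_deltaMove`): a closed smooth 4-manifold `X` is a Cappell–Shaneson sphere of `A` iff it
is one of `B`. Conjugation: `IsCappellShanesonSphereOf.of_isConj` (KY Remark 2.3). Δ-move: a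
sphere `X` of `A` is diffeomorphic to a sphere `X'` of `Δᵏ A`, so `X` itself is a sphere of `Δᵏ A`
(`IsCappellShanesonSphereOf.of_diffeomorph`); conversely by
`gompf2010_deltaMove.of_gompfDelta_zpow_mul` (KY Thm. 2.16: "`Σ^ε_{Δᵏ A}` are diffeomorphic to
`Σ^ε_A` for every integer `k` and `ε ∈ ℤ₂`"). [cite: KimYamada2023, Thm. 2.16 and Remark 2.17] -/
theorem IsGompfMove.isCappellShanesonSphereOf_iff (hΔ : gompf2010_deltaMove.{u}) {A B : SL(3, ℤ)}
    (h : IsGompfMove A B) : IsCappellShanesonSphereOf A X ↔ IsCappellShanesonSphereOf B X := by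
  rcases h with h | ⟨hA, hdet, k, rfl⟩
  · exact ⟨fun hX => hX.of_isConj h, fun hX => hX.of_isConj h.symm⟩
  · refine ⟨fun hX => ?_, fun hX => ?_⟩
    · obtain ⟨X', _, _, _, _, _, _, hX', ⟨e⟩⟩ := hΔ A hA hdet k X hX
      exact hX'.of_diffeomorph e.symm
    · obtain ⟨X', _, _, _, _, _, _, hX', ⟨e⟩⟩ := hΔ.of_gompfDelta_zpow_mul hA hdet k X hX
      exact hX'.of_diffeomorph e.symm

/-- **Gompf equivalent matrices have the same Cappell–Shaneson spheres** (KY Remark 2.17: "the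
content of Theorem 2.16 is that two standard matrices `X_{c,d,n}` and `X_{c,d,n+kd}` give
diffeomorphic homotopy 4-spheres"; with Remark 2.3 for `∼_S`), granted `gompf2010_deltaMove`:
induction along the generating moves. [cite: KimYamada2023, Thm. 2.16 and Remark 2.17] -/
theorem GompfEquiv.isCappellShanesonSphereOf_iff (hΔ : gompf2010_deltaMove.{u}) {A B : SL(3, ℤ)}
    (h : GompfEquiv A B) : IsCappellShanesonSphereOf A X ↔ IsCappellShanesonSphereOf B X := by
  induction h with
  | rel A B hAB => exact hAB.isCappellShanesonSphereOf_iff X hΔ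
  | refl A => exact Iff.rfl
  | symm A B _ ih => exact ih.symm
  | trans A B C _ _ ih₁ ih₂ => exact ih₁.trans ih₂

/-- **Kim–Yamada 2023, Remark 1.1 (proved relative to the leaves): a matrix Gompf equivalent to
`A₀` has only standard Cappell–Shaneson spheres.** "If Conjecture 2 is true for trace `n`, then
Conjecture 1 is true for every matrix with trace `n`": if `A ∼ A₀` then every Cappell–Shaneson
sphere `X` of `A` (either framing) is a Cappell–Shaneson sphere of `A₀`
(`GompfEquiv.isCappellShanesonSphereOf_iff`), hence diffeomorphic to `S⁴` since both spheres of
`A₀` are standard — Gompf 2010, Examples 3.1(a): "[AK1] for the untwisted framing and Theorem 4.3",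
the tree's assembly `nonempty_diffeomorph_sphere_four_of_isCappellShanesonSphereOf_of` at `m = 0`.
Hypotheses: the three topological leaves `gompf2010_deltaMove` (Thm. 2.1/§3),
`gompf2010_akbulutKirby_framings` (Thm. 4.3), `akbulutKirby1979_sphere_four` ([AK1]). [cite: KimYamada2023, Remark 1.1] -/
theorem nonempty_diffeomorph_sphere_four_of_gompfEquiv_akbulutKirbyMatrix
    (hΔ : gompf2010_deltaMove.{u}) (h43 : gompf2010_akbulutKirby_framings.{0, 0})
    (hAK : akbulutKirby1979_sphere_four) {A : SL(3, ℤ)} (h : GompfEquiv A akbulutKirbyMatrix)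
    (hX : IsCappellShanesonSphereOf A X) : Nonempty (X ≃ₘ⟮𝓡 4, 𝓡 4⟯ ↥(𝕊 4)) := by
  have h₀ : IsCappellShanesonSphereOf (cappellShanesonMatrix 0) X := by
    rw [cappellShanesonMatrix_zero]
    exact (h.isCappellShanesonSphereOf_iff X hΔ).1 hX
  exact nonempty_diffeomorph_sphere_four_of_isCappellShanesonSphereOf_of X hΔ h43 hAK 0 h₀

/-- **Remark 1.1 as printed**: if Gompf's conjecture is true for trace `n`, then every
Cappell–Shaneson sphere of every matrix of trace `n` (`det (A - 1) = 1`, either framing) is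
diffeomorphic to `S⁴` — granted the three topological leaves. [cite: KimYamada2023, Remark 1.1] -/
theorem nonempty_diffeomorph_sphere_four_of_gompfConjectureForTrace
    (hΔ : gompf2010_deltaMove.{u}) (h43 : gompf2010_akbulutKirby_framings.{0, 0})
    (hAK : akbulutKirby1979_sphere_four) {n : ℤ} (hn : GompfConjectureForTrace n) {A : SL(3, ℤ)}
    (hdet : ((A : Matrix (Fin 3) (Fin 3) ℤ) - 1).det = 1)
    (htr : Matrix.trace (A : Matrix (Fin 3) (Fin 3) ℤ) = n) (hX : IsCappellShanesonSphereOf A X) :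
    Nonempty (X ≃ₘ⟮𝓡 4, 𝓡 4⟯ ↥(𝕊 4)) :=
  nonempty_diffeomorph_sphere_four_of_gompfEquiv_akbulutKirbyMatrix X hΔ h43 hAK (hn A hdet htr) hX

/-- **Cappell–Shaneson spheres of trace `-4 ≤ tr A ≤ 9` are standard, from the three topological
leaves alone** (the number theory being PROVED, `gompfConjectureForTrace_of_mem_Icc`): Gompf 2010,
Thm. 3.2 for these traces / KY Cor. C restricted to `[-4, 9]`. [cite: GompfAGT2010, Thm. 3.2] -/
theorem nonempty_diffeomorph_sphere_four_of_trace_mem_Icc_neg_four_nine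
    (hΔ : gompf2010_deltaMove.{u}) (h43 : gompf2010_akbulutKirby_framings.{0, 0})
    (hAK : akbulutKirby1979_sphere_four) {A : SL(3, ℤ)}
    (hdet : ((A : Matrix (Fin 3) (Fin 3) ℤ) - 1).det = 1)
    (htr : Matrix.trace (A : Matrix (Fin 3) (Fin 3) ℤ) ∈ Icc (-4 : ℤ) 9)
    (hX : IsCappellShanesonSphereOf A X) : Nonempty (X ≃ₘ⟮𝓡 4, 𝓡 4⟯ ↥(𝕊 4)) :=
  nonempty_diffeomorph_sphere_four_of_gompfConjectureForTrace X hΔ h43 hAK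
    (gompfConjectureForTrace_of_mem_Icc htr) hdet rfl hX

end Transport

/-! ### Kim–Yamada's Corollary C from Theorem B and the leaves -/

section CorollaryC

/-- **Kim–Yamada 2023, Cor. C ⇐ Thm. B + Remark 1.1 (the reduction of the named fact, proved).**
The tree's named fact `kimYamada2023_nonempty_diffeomorph_sphere_four_of_trace_mem_Icc` (Cor. C:
every Cappell–Shaneson sphere of a matrix with `det (A - 1) = 1` and `-64 ≤ tr A ≤ 69` is `S⁴`)
follows — exactly as in the paper, "By Remark 1.1, Corollary C immediately follows from Theorem B"
(§1.2) — from Theorem B in matrix form (hypothesis `hB`: Gompf's conjecture is true for every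
trace `n ∈ [-64, 69]`; its printed proof, §6.1, is the MAGMA computation of minimal
representatives of the ideal class monoids `C(ℤ[Θₙ])`, `3 ≤ n ≤ 69`, the induction Lemma 6.1 and a
handful of explicit Gompf equivalences, with Thm. A for `n ↦ 5 - n`) and the three topological leaves
of `CappellShanesonGompfReduction.lean`. Hence the discharge `…_holds` of the named fact amounts to
Theorem B (pure algebra) plus `gompf2010_deltaMove`, `gompf2010_akbulutKirby_framings`,
`akbulutKirby1979_sphere_four`. [cite: KimYamada2023, Thm. B and Cor. C (§1.2)] -/
theorem kimYamada2023_nonempty_diffeomorph_sphere_four_of_trace_mem_Icc_of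
    (hΔ : gompf2010_deltaMove.{u}) (h43 : gompf2010_akbulutKirby_framings.{0, 0})
    (hAK : akbulutKirby1979_sphere_four)
    (hB : ∀ n ∈ Icc (-64 : ℤ) 69, GompfConjectureForTrace n) :
    kimYamada2023_nonempty_diffeomorph_sphere_four_of_trace_mem_Icc.{u} := by
  intro A hA htr X _ _ _ _ _ _ hX
  exact nonempty_diffeomorph_sphere_four_of_gompfConjectureForTrace X hΔ h43 hAK (hB _ htr) hA rfl
    hX

end CorollaryC

end Literature.Topology.FourManifolds

end
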